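import Summits.KontsevichZagierPeriods.KontsevichZagierPeriods.Theses.UnfoldedStokes
import Summits.KontsevichZagierPeriods.KontsevichZagierPeriods.Theorems.UnfoldedStokesCubeKernelStepStubSlabGluing
import Literature.NumberTheory.Transcendental.KZCubicalCalculus
import Literature.NumberTheory.Transcendental.KZLogCalculusProofs

/-!
# STRATEGY CENSUS (typed part) — crux `CubeKernelStep` (stmt-KontsevichZagierPeriods-17854), strategist s1

Companion to `STRATEGY-CENSUS.md`: the signatures of the strengthenings / decompositions attempted,
with the cheap implications kernel-checked (no `sorry`). Nothing here is a route item; the FILED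
decomposition and its glue live in `Split.lean`.

* `FibreNullLayer` (S-b): the GLOBAL form of child 2; `fibreNullLayer_of_fibreNullGerm` (PROVED: the
  germ form implies the global form through the landed slab gluing — so registering K1 in germ form
  costs nothing downstream).
* `SquareStep` / `HigherSteps` (D-b): the split by dimension; glue `cubeKernelStep_of_dimension_split`
  is a case split on `d` (PROVED, trivial seam) — rejected as a filing (both pieces have the same plan).
* `DimReduction` (S-a): "every continuous closed `(d+1)`-cube representation is congruent to a continuous
  closed `d`-cube one"; `cubeKernelStep_of_dimReduction` (PROVED) — but `DimReduction 2` is believed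
  FALSE (weight: a `Li₃`-type value is not a 2-dimensional period with algebraic integrand), and its
  restriction to value `0` is the crux reworded: rejected.
* `FibreNullFiniteRank` (S-e): finite-rank fibre-null families are relations under `K(≤d)` — PROVABLE
  NOW (linear algebra over real algebraic numbers + the ideal), the first rung to hand to child 2's
  chain; contrast: finite-rank VALUE-ZERO families are the tensor kernel of card kunneth-peel
  (Legendre is rank 3), GPC in degree 2. This asymmetry is the rationale of the filed cut.
* `MarginalSemialgebraic` (S-c): the weakening of child 1 to "semialgebraic marginal";
  `marginalSemialgebraic_of_meanRealisation` (PROVED, marginal `0`); the converse holds modulo `Kc 1`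
  (Newton–Leibniz along a fibre coordinate with primitive `x₁·W(s)`), so no strength is gained or lost.
-/

noncomputable section

set_option linter.dupNamespace false

namespace Summit.KontsevichZagierPeriods.KontsevichZagierPeriods.CubeKernelStepCensusS1

open MeasureTheory Set Filter Metric
open scoped Topology
open Literature.NumberTheory.Transcendental
open Literature.NumberTheory.Transcendental.KZ
open Summit.KontsevichZagierPeriods.KontsevichZagierPeriods.Theses.UnfoldedStokes (CubeKernelStep)

/-- The lower layers `K(≤d)` (the crux's induction hypothesis), abbreviated. -/
def LowerLayers (d : ℕ) : Prop :=
  ∀ (M : ℕ), M ≤ d → ∀ (a : IntegralRep M),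
    a.domain = Set.pi Set.univ (fun _ : Fin M => Set.Icc (0:ℝ) 1) →
    ContinuousOn a.integrand a.domain → a.value = 0 → of a ∈ relations

/-- Layer `M` of the continuous closed-cube kernel (`Kc M`). -/
def Kc (M : ℕ) : Prop :=
  ∀ (t : IntegralRep M), t.domain = Set.pi Set.univ (fun _ : Fin M => Set.Icc (0:ℝ) 1) →
    ContinuousOn t.integrand t.domain → t.value = 0 → of t ∈ relations

theorem lowerLayers_iff (d : ℕ) : LowerLayers d ↔ ∀ M, M ≤ d → Kc M := Iff.rfl

theorem cubeKernelStep_iff_layers : CubeKernelStep ↔ ∀ d, 1 ≤ d → LowerLayers d → Kc (d + 1) :=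
  Iff.rfl

/-! ## S-b: germ form versus global form of child 2 -/

/-- Child 2 in GERM form (verbatim the registered stub / the filed child `FibreNullGerm`). -/
def FibreNullGerm : Prop :=
  ∀ d : ℕ, 1 ≤ d → LowerLayers d →
    ∀ (t : IntegralRep (d + 1)),
      t.domain = Set.pi Set.univ (fun _ : Fin (d + 1) => Set.Icc (0:ℝ) 1) →
      ContinuousOn t.integrand t.domain →
      (∀ s ∈ Set.Icc (0:ℝ) 1, sliceValue t s = 0) →
      ∀ s₀ ∈ Set.Icc (0:ℝ) 1, ∃ ε : ℝ, 0 < ε ∧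
        ∀ a b : ℚ, s₀ - ε ≤ (a : ℝ) → (a : ℝ) < b → (b : ℝ) ≤ s₀ + ε →
          of (t.slabRestrict a b) ∈ relations

/-- Child 2 in GLOBAL form (the card's `FibreNullLayer`, with `K(≤d)` as a hypothesis instead of the
ideal `I_d` in the conclusion). -/
def FibreNullLayer : Prop :=
  ∀ d : ℕ, 1 ≤ d → LowerLayers d →
    ∀ (t : IntegralRep (d + 1)),
      t.domain = Set.pi Set.univ (fun _ : Fin (d + 1) => Set.Icc (0:ℝ) 1) →
      ContinuousOn t.integrand t.domain →
      (∀ s ∈ Set.Icc (0:ℝ) 1, sliceValue t s = 0) → of t ∈ relations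

/-- Lebesgue-number step (as in `Split.lean`). [folklore] -/
theorem exists_equipartition_of_germs {d : ℕ} (t : IntegralRep (d + 1))
    (hgerm : ∀ s₀ ∈ Set.Icc (0:ℝ) 1, ∃ ε : ℝ, 0 < ε ∧
      ∀ a b : ℚ, s₀ - ε ≤ (a : ℝ) → (a : ℝ) < b → (b : ℝ) ≤ s₀ + ε →
        of (t.slabRestrict a b) ∈ relations) :
    ∃ N : ℕ, 0 < N ∧
      ∀ k : ℕ, k < N → of (t.slabRestrict ((k : ℚ) / N) (((k : ℚ) + 1) / N)) ∈ relations := by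
  classical
  choose! ε hε hslab using hgerm
  obtain ⟨δ, hδ, hcov⟩ := lebesgue_number_lemma_of_metric (ι := Set.Icc (0:ℝ) 1) isCompact_Icc
    (c := fun i => ball (i : ℝ) (ε i)) (fun _ => isOpen_ball)
    (fun x hx => Set.mem_iUnion.mpr ⟨⟨x, hx⟩, mem_ball_self (hε x hx)⟩)
  obtain ⟨N, hN⟩ := exists_nat_one_div_lt hδ
  refine ⟨N + 1, Nat.succ_pos N, fun k hk => ?_⟩
  have hNpos : (0:ℝ) < (N + 1 : ℕ) := by exact_mod_cast Nat.succ_pos N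
  have hk' : (k : ℝ) ≤ N := by exact_mod_cast Nat.lt_succ_iff.mp hk
  set x : ℝ := (k : ℝ) / (N + 1 : ℕ) with hx
  have hx0 : 0 ≤ x := div_nonneg (Nat.cast_nonneg k) hNpos.le
  have hx1 : x ≤ 1 := by
    rw [hx, div_le_one hNpos]; push_cast; linarith
  obtain ⟨⟨s₀, hs₀⟩, hball⟩ := hcov x ⟨hx0, hx1⟩
  have hmesh : (1:ℝ) / (N + 1 : ℕ) < δ := by simpa using hN
  have hxs : x ∈ ball s₀ (ε s₀) := hball (mem_ball_self hδ)
  have hys : x + 1 / (N + 1 : ℕ) ∈ ball s₀ (ε s₀) := by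
    refine hball ?_
    rw [mem_ball, Real.dist_eq, add_sub_cancel_left, abs_of_pos (by positivity)]
    exact hmesh
  rw [mem_ball, Real.dist_eq, abs_lt] at hxs hys
  refine hslab s₀ hs₀ _ _ ?_ ?_ ?_
  · have : (((k : ℚ) / (N + 1 : ℕ) : ℚ) : ℝ) = x := by rw [hx]; push_cast; ring
    rw [this]; linarith [hxs.1]
  · push_cast
    exact div_lt_div_of_pos_right (by linarith) (by exact_mod_cast Nat.succ_pos N)
  · have : ((((k : ℚ) + 1) / (N + 1 : ℕ) : ℚ) : ℝ) = x + 1 / (N + 1 : ℕ) := by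
      rw [hx]; push_cast; ring
    rw [this]; linarith [hys.2]

/-- **S-b. Germ ⇒ global** (so filing the germ form costs nothing downstream): Lebesgue number +
the landed slab gluing. [folklore] -/
theorem fibreNullLayer_of_fibreNullGerm (h : FibreNullGerm) : FibreNullLayer := by
  intro d hd hLE t htd htc hnull
  obtain ⟨N, hN, hk⟩ := exists_equipartition_of_germs t (h d hd hLE t htd htc hnull)
  exact Summit.KontsevichZagierPeriods.KontsevichZagierPeriods.Cruxes.CubeKernelStep.Layers.stub_slabGluing
    d t htd N hN hk

/-! ## D-b: the split by dimension (typed; trivial seam; NOT filed) -/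

/-- First layer: interval ⇒ square. -/
def SquareStep : Prop := LowerLayers 1 → Kc 2

/-- All higher layers. -/
def HigherSteps : Prop := ∀ d, 2 ≤ d → LowerLayers d → Kc (d + 1)

/-- **D-b glue** (a case split on `d`; `trivial_seam`). [folklore] -/
theorem cubeKernelStep_of_dimension_split (h1 : SquareStep) (h2 : HigherSteps) : CubeKernelStep := by
  intro d hd hLE
  rcases Nat.lt_or_ge d 2 with hlt | hge
  · obtain rfl : d = 1 := le_antisymm (Nat.lt_succ_iff.mp hlt) hd
    exact h1 hLE
  · exact h2 d hge hLE

theorem squareStep_of_cubeKernelStep (h : CubeKernelStep) : SquareStep := h 1 le_rfl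

theorem higherSteps_of_cubeKernelStep (h : CubeKernelStep) : HigherSteps :=
  fun d hd => h d (le_trans (by norm_num) hd)

/-! ## S-a: dimension reduction of the REPRESENTATION (typed; believed false; NOT filed) -/

/-- `DimReduction (d+1)`: every continuous closed `(d+1)`-cube representation is congruent modulo
relations to a continuous closed `d`-cube representation (hence of the same value, by soundness).
Believed FALSE already for `d + 1 = 3` (a `Li₃(1/2)`-type value such as `∫_{[0,1]³} dz/(2 − z₀z₁z₂)`
is, by weight, not expected to be a 2-dimensional period with algebraic integrand), not refutable in
Lean without transcendence input; its restriction to value-`0` representations is `Kc (d+1)` itself. -/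
def DimReduction (n : ℕ) : Prop :=
  ∀ (t : IntegralRep (n + 1)), t.domain = Set.pi Set.univ (fun _ : Fin (n + 1) => Set.Icc (0:ℝ) 1) →
    ContinuousOn t.integrand t.domain →
    ∃ (u : IntegralRep n), u.domain = Set.pi Set.univ (fun _ : Fin n => Set.Icc (0:ℝ) 1) ∧
      ContinuousOn u.integrand u.domain ∧ of t - of u ∈ relations

/-- **S-a.** `DimReduction` at every level above `1` gives the crux (soundness transports the value,
the lower layer kills `u`). [folklore] -/
theorem cubeKernelStep_of_dimReduction (h : ∀ d, 1 ≤ d → DimReduction d) : CubeKernelStep := by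
  intro d hd hLE t htd htc hval
  obtain ⟨u, hud, huc, htu⟩ := h d hd t htd htc
  have hvu : u.value = 0 := by
    have := Equivalent.value_eq_holds htu
    rw [← this, hval]
  have hu : of u ∈ relations := hLE d le_rfl u hud huc hvu
  have e : of t = (of t - of u) + of u := by abel
  rw [e]
  exact relations.add_mem htu hu

/-! ## S-e: finite-rank FIBRE-NULL families (typed; provable now; the first rung for child 2's chain) -/

/-- `FibreNullFiniteRank`: under `K(≤d)`, a continuous closed `(d+1)`-cube family whose integrand is a
FINITE sum `Σ_{i<k} b i (z 0) · a i (tail z)` of products of continuous `ℚ`-semialgebraic functions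
and which is fibre-null over `z 0` is a relation. Provable now: the `b i` span a finite-dimensional
space with a basis among them and REAL-ALGEBRAIC coordinates (values of `ℚ`-semialgebraic functions at
rational points), fibre-nullness makes every basis coefficient `Σ_i q_{ij} ∫ a i` vanish, `K(≤d)`
kills `Σ_i q_{ij} a i`, and `relations` is a two-sided ideal for the Fubini product
(`KZ.mul_mem_relations_left_holds`). Contrast: with `value = 0` in place of fibre-null this is the
tensor kernel `T_{1,d}` (card kunneth-peel) — Legendre's relation is a rank-3 instance — GPC in degree 2. -/
def FibreNullFiniteRank : Prop :=
  ∀ d : ℕ, 1 ≤ d → LowerLayers d →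
    ∀ (k : ℕ) (b : Fin k → ℝ → ℝ) (a : Fin k → (Fin d → ℝ) → ℝ),
      (∀ i, IsSemialgebraicFunOn ℚ (Set.Icc (0 : Fin 1 → ℝ) 1) (fun y => b i (y 0))) →
      (∀ i, IsSemialgebraicFunOn ℚ (Set.pi Set.univ (fun _ : Fin d => Set.Icc (0:ℝ) 1)) (a i)) →
      (∀ i, ContinuousOn (b i) (Set.Icc (0:ℝ) 1)) →
      (∀ i, ContinuousOn (a i) (Set.pi Set.univ (fun _ : Fin d => Set.Icc (0:ℝ) 1))) →
      ∀ (t : IntegralRep (d + 1)),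
        t.domain = Set.pi Set.univ (fun _ : Fin (d + 1) => Set.Icc (0:ℝ) 1) →
        Set.EqOn t.integrand (fun z => ∑ i, b i (z 0) * a i (Fin.tail z)) t.domain →
        (∀ s ∈ Set.Icc (0:ℝ) 1, sliceValue t s = 0) → of t ∈ relations

/-- Sanity: the rung is an instance of the global child 2. [folklore] -/
theorem fibreNullFiniteRank_of_fibreNullLayer (h : FibreNullLayer) : FibreNullFiniteRank := by
  intro d hd hLE k b a _ _ hbc hac t htd hti hnull
  refine h d hd hLE t htd ?_ hnull
  refine ContinuousOn.congr ?_ hti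
  refine continuousOn_finsetSum _ fun i _ => ContinuousOn.mul ?_ ?_
  · refine (hbc i).comp (continuous_apply 0).continuousOn fun z hz => ?_
    rw [htd] at hz
    exact hz 0 (Set.mem_univ _)
  · refine (hac i).comp (Continuous.continuousOn (by fun_prop)) fun z hz => ?_
    rw [htd] at hz
    exact fun j _ => hz j.succ (Set.mem_univ _)

/-! ## S-c: semialgebraic-marginal realisation (typed; equivalent to child 1 modulo `Kc 1`) -/

/-- `MarginalSemialgebraic`: as child 1, but the new family `t'` is only asked to have a slice
function agreeing on `[0,1]` with a CONTINUOUS `ℚ`-SEMIALGEBRAIC function `W` (instead of `0`). -/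
def MarginalSemialgebraic : Prop :=
  ∀ d : ℕ, 1 ≤ d → LowerLayers d →
    ∀ (t : IntegralRep (d + 1)),
      t.domain = Set.pi Set.univ (fun _ : Fin (d + 1) => Set.Icc (0:ℝ) 1) →
      ContinuousOn t.integrand t.domain → t.value = 0 →
      ∃ (t' : IntegralRep (d + 1)) (W : ℝ → ℝ),
        t'.domain = Set.pi Set.univ (fun _ : Fin (d + 1) => Set.Icc (0:ℝ) 1) ∧
        ContinuousOn t'.integrand t'.domain ∧
        IsSemialgebraicFunOn ℚ (Set.Icc (0 : Fin 1 → ℝ) 1) (fun y => W (y 0)) ∧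
        ContinuousOn W (Set.Icc (0:ℝ) 1) ∧
        (∀ s ∈ Set.Icc (0:ℝ) 1, sliceValue t' s = W s) ∧
        of t - of t' ∈ relations

/-- Child 1 (verbatim the filed `MeanRealisation`). -/
def MeanRealisation : Prop :=
  ∀ d : ℕ, 1 ≤ d → LowerLayers d →
    ∀ (t : IntegralRep (d + 1)),
      t.domain = Set.pi Set.univ (fun _ : Fin (d + 1) => Set.Icc (0:ℝ) 1) →
      ContinuousOn t.integrand t.domain → t.value = 0 →
      ∃ t' : IntegralRep (d + 1),
        t'.domain = Set.pi Set.univ (fun _ : Fin (d + 1) => Set.Icc (0:ℝ) 1) ∧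
        ContinuousOn t'.integrand t'.domain ∧
        (∀ s ∈ Set.Icc (0:ℝ) 1, sliceValue t' s = 0) ∧
        of t - of t' ∈ relations

/-- **S-c, easy direction**: child 1 gives the semialgebraic-marginal form with `W = 0`. [folklore] -/
theorem marginalSemialgebraic_of_meanRealisation (h : MeanRealisation) : MarginalSemialgebraic := by
  intro d hd hLE t htd htc hval
  obtain ⟨t', h1, h2, h3, h4⟩ := h d hd hLE t htd htc hval
  refine ⟨t', fun _ => 0, h1, h2, ?_, continuousOn_const, fun s hs => by simpa using h3 s hs, h4⟩
  have hS : Literature.ModelTheory.ExponentialFields.IsSemialgebraic ℚ (Set.Icc (0 : Fin 1 → ℝ) 1) := by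
    rw [← cube_eq_Icc]; exact isSemialgebraic_cube
  exact (isSemialgebraicFunOn_aeval hS 0).congr fun x _ => by simp

end Summit.KontsevichZagierPeriods.KontsevichZagierPeriods.CubeKernelStepCensusS1

end
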